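import Summits.ValiantsHypothesis.ValiantsHypothesis.Theorems.BarrierLeverHubToolkit
import Summits.ValiantsHypothesis.ValiantsHypothesis.Theorems.BarrierLeverCompressionMove

/-!
# Route BarrierLever — a CHECKER for hub/compression-word certificates (TT, item 19152 / residual 19930)

Library file (`--supports stmt-ValiantsHypothesis-19930`; cell valiant-natproofs, rung V4, 𝒟-side of door
(c); prover gen 9, memo `HOME/prover/gen9/HUB-MEMO-g9.md`). It does NOT import the route file.

Gen 8's certificates (`…Theorems.BarrierLeverHubCertificateEvenClaw`, `…HubCertificateFaceClaw`) spell out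
every compression step as a `Compression.compressionMove` application with hand-supplied bookkeeping data
and restated `Function.update` terms — impractical for the h = 4 census (kit j264956: 3015 words of length
≤ 9 at r ≤ 16). Here the bookkeeping is COMPUTED and the certificate is CHECKED BY `decide`:
* `compress κ x y` — the classical compression `C_{y←x}` of a column configuration `κ : Fin r → Fin d →
  Fin n` (replace `x` by `y` in every column that hits `x`, avoids `y`, and whose image is not already a
  column up to slot order; blocked columns stay); computable, side conditions decidable over `Fin`;
* `alive_of_compress` — `(R, compress κ x y)` alive ⟹ `(R, κ)` alive (`compressionMove`, p478445, with all
  its data discharged once and for all);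
* a WORD CERTIFICATE is a list of steps `(x, y, κ')`, each claiming `κ' = compress κ x y`; `stepsOK` (a
  `Bool`) checks the claims, `lastCfg` is the end configuration, and the END CHECK
  `∀ j', ∃ j, ∀ q, ∃ q', σ (H j' q) = K j q'` says every member of the relabeled hub `σ ∘ H` is, as a set,
  a column of `K`; `alive_of_wordCert` turns a checked word into the input of the hub lemma;
* `tt_of_hubCert` — threshold hub (`Hub.hub_unique_of_threshold`, p478917) + hub lemma
  (`Hub.alive_trans_of_hub`, p477861) + two checked words (ending at relabelings `σ₁ ∘ H`, `σ₂ ∘ H` of ONE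
  hub) ⟹ the layout `(S, T)` is alive; `layout_alive_of_eq` converts to the item's `Finset` indexing.
A complete TT certificate is now the hub data plus a handful of `decide`s (gen 8's face × claw layout
re-certifies in 12 lines and 3 s: companion file `…HubWordCertificatesDemo`).

WHAT THIS IS NOT: a checker and its soundness; it finds no words and says nothing on their existence
(item 19930), on TT / TNS / item 19717 in general, on crux stmt-ValiantsHypothesis-14610, or on `VP` versus
`VNP`.
-/

-- layout Summits/ValiantsHypothesis/ValiantsHypothesis forces the duplicated namespace component
set_option linter.dupNamespace false

namespace Summit.ValiantsHypothesis.ValiantsHypothesis.Theorems.BarrierLever.HubCert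

open Matrix Compression Hub

variable {r d n nr : ℕ}

/-! ## 1. The computable compression -/

/-- The image of a column under the literal substitution `x ↦ y` (in place). -/
def subst (c : Fin d → Fin n) (x y : Fin n) : Fin d → Fin n := fun q => if c q = x then y else c q

/-- The compression `C_{y←x}` of a column configuration `κ`: a column is ELIGIBLE if it hits `x` and
avoids `y`; it is BLOCKED if moreover its image under `x ↦ y` is (as a set of literals) already a column;
every eligible unblocked column is replaced by its image, all other columns stay. All side conditions
are decidable propositions over `Fin`, so `compress` evaluates by `decide`. -/
def compress (κ : Fin r → Fin d → Fin n) (x y : Fin n) : Fin r → Fin d → Fin n := fun j =>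
  if ((∃ q, κ j q = x) ∧ ∀ q, κ j q ≠ y) ∧ ¬ ∃ j', ∀ q, ∃ q', subst (κ j) x y q = κ j' q'
  then subst (κ j) x y else κ j

/-! ## 2. Word certificates (checked by `decide`) -/

/-- Check a word certificate step by step: each step `(x, y, κ')` must have `x ≠ y` and `κ'` must BE the
compression of the current configuration. -/
def stepsOK : (Fin r → Fin d → Fin n) → List (Fin n × Fin n × (Fin r → Fin d → Fin n)) → Bool
  | _, [] => true
  | κ, (x, y, κ') :: rest => decide (x ≠ y) && decide (κ' = compress κ x y) && stepsOK κ' rest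

/-- The end configuration of a word certificate (the last recorded configuration, or the start). -/
def lastCfg : (Fin r → Fin d → Fin n) → List (Fin n × Fin n × (Fin r → Fin d → Fin n)) →
    (Fin r → Fin d → Fin n)
  | κ, [] => κ
  | _, (_, _, κ') :: rest => lastCfg κ' rest

/-! ## 3. Soundness of one compression step -/

/-- The image of an eligible injective column is injective. -/
theorem subst_injective (c : Fin d → Fin n) (x y : Fin n) (hc : Function.Injective c)
    (he : (∃ q, c q = x) ∧ ∀ q, c q ≠ y) : Function.Injective (subst c x y) := by
  intro q₁ q₂ hq
  unfold subst at hq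
  by_cases h₁ : c q₁ = x
  · by_cases h₂ : c q₂ = x
    · exact hc (h₁.trans h₂.symm)
    · rw [if_pos h₁, if_neg h₂] at hq
      exact absurd hq.symm (he.2 q₂)
  · by_cases h₂ : c q₂ = x
    · rw [if_neg h₁, if_pos h₂] at hq
      exact absurd hq (he.2 q₁)
    · rw [if_neg h₁, if_neg h₂] at hq
      exact hc hq

/-- Compression preserves injectivity of the columns. -/
theorem compress_injective (κ : Fin r → Fin d → Fin n) (x y : Fin n)
    (hκ : ∀ j, Function.Injective (κ j)) (j : Fin r) : Function.Injective (compress κ x y j) := by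
  unfold compress
  by_cases hm : ((∃ q, κ j q = x) ∧ ∀ q, κ j q ≠ y) ∧ ¬ ∃ j', ∀ q, ∃ q', subst (κ j) x y q = κ j' q'
  · rw [if_pos hm]
    exact subst_injective _ x y (hκ j) hm.1
  · rw [if_neg hm]
    exact hκ j

/-- On an injective column hitting `x` at slot `q₀`, the substitution is the slot update. -/
theorem subst_eq_update (c : Fin d → Fin n) (x y : Fin n) (hc : Function.Injective c) (q₀ : Fin d)
    (hq₀ : c q₀ = x) : subst c x y = Function.update c q₀ y := by
  funext q
  unfold subst
  by_cases hq : q = q₀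
  · subst hq
    rw [if_pos hq₀, Function.update_self]
  · rw [Function.update_of_ne hq, if_neg]
    intro hx
    exact hq (hc (hx.trans hq₀.symm))

/-- An injective slot map covered by another slot map (every literal of `f` is a literal of `g`)
differs from it by a slot permutation. -/
theorem exists_perm_of_covers (f g : Fin d → Fin n) (hf : Function.Injective f)
    (h : ∀ q, ∃ q', f q = g q') : ∃ τ : Equiv.Perm (Fin d), f = g ∘ τ := by
  classical
  choose t ht using h
  have hti : Function.Injective t := fun q₁ q₂ hq => hf (by rw [ht q₁, ht q₂, hq])
  exact ⟨Equiv.ofBijective t (Finite.injective_iff_bijective.mp hti), funext fun q => ht q⟩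

/-- **One step.** If the compressed configuration `(R, compress κ x y)` is alive, so is `(R, κ)`:
`Compression.compressionMove` with its bookkeeping data computed from `κ, x, y`. -/
theorem alive_of_compress (R : Fin r → Fin d → Fin nr) (κ : Fin r → Fin d → Fin n)
    (hκ : ∀ j, Function.Injective (κ j)) (x y : Fin n) (hxy : x ≠ y)
    (h : ∃ G : Matrix (Fin nr) (Fin n) ℂ,
      (Matrix.of fun i j : Fin r => (G.submatrix (R i) (compress κ x y j)).det).det ≠ 0) :
    ∃ G : Matrix (Fin nr) (Fin n) ℂ,
      (Matrix.of fun i j : Fin r => (G.submatrix (R i) (κ j)).det).det ≠ 0 := by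
  classical
  rcases Nat.eq_zero_or_pos d with hd | hd
  · subst hd
    have hc : compress κ x y = κ := by
      funext j q
      exact q.elim0
    rw [hc] at h
    exact h
  · -- abbreviations for the side predicates
    let E : Fin r → Prop := fun j => (∃ q, κ j q = x) ∧ ∀ q, κ j q ≠ y
    let B : Fin r → Prop := fun j => ∃ j', ∀ q, ∃ q', subst (κ j) x y q = κ j' q'
    have hcompress : ∀ j, compress κ x y j = if E j ∧ ¬ B j then subst (κ j) x y else κ j :=
      fun j => rfl
    have hqx0 : ∀ j, ∃ q : Fin d, (∃ q', κ j q' = x) → κ j q = x := by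
      intro j
      by_cases hq : ∃ q', κ j q' = x
      · obtain ⟨q, hq'⟩ := hq
        exact ⟨q, fun _ => hq'⟩
      · exact ⟨⟨0, hd⟩, fun h' => absurd h' hq⟩
    choose qx hqx using hqx0
    have hps0 : ∀ j, ∃ (j' : Fin r) (τ : Equiv.Perm (Fin d)),
        E j ∧ B j → subst (κ j) x y = κ j' ∘ τ := by
      intro j
      by_cases hb : E j ∧ B j
      · obtain ⟨j', hj'⟩ := hb.2
        obtain ⟨τ, hτ⟩ := exists_perm_of_covers _ _ (subst_injective _ x y (hκ j) hb.1) hj'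
        exact ⟨j', τ, fun _ => hτ⟩
      · exact ⟨j, 1, fun h' => absurd h' hb⟩
    choose partner sgn hps using hps0
    refine compressionMove (ι := Fin r) R κ hκ x y hxy (fun j => decide (E j ∧ ¬ B j))
      (fun j => decide (E j ∧ B j)) qx partner sgn ?_ ?_ ?_ ?_ ?_
    · intro j hj
      have hm : E j ∧ ¬ B j := of_decide_eq_true hj
      exact ⟨hqx j hm.1.1, hm.1.2⟩
    · intro j hj
      have hb : E j ∧ B j := of_decide_eq_true hj
      refine ⟨hqx j hb.1.1, hb.1.2, ?_⟩
      rw [← subst_eq_update _ x y (hκ j) (qx j) (hqx j hb.1.1)]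
      exact hps j hb
    · rintro j ⟨h1, h2⟩
      exact (of_decide_eq_true h1).2 (of_decide_eq_true h2).2
    · intro j h1 h2
      have hm : ¬ (E j ∧ ¬ B j) := fun hm => by
        rw [decide_eq_true hm] at h1
        exact Bool.noConfusion h1
      have hb : ¬ (E j ∧ B j) := fun hb => by
        rw [decide_eq_true hb] at h2
        exact Bool.noConfusion h2
      have he : ¬ E j := fun he => by
        by_cases hB : B j
        · exact hb ⟨he, hB⟩
        · exact hm ⟨he, hB⟩
      by_cases hx : ∃ q, κ j q = x
      · right
        by_contra hy
        push Not at hy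
        exact he ⟨hx, hy⟩
      · left
        push Not at hx
        exact hx
    · obtain ⟨G, hG⟩ := h
      refine ⟨G, ?_⟩
      have hcol : ∀ j, (if decide (E j ∧ ¬ B j) then Function.update (κ j) (qx j) y else κ j) =
          compress κ x y j := by
        intro j
        rw [hcompress j]
        by_cases hm : E j ∧ ¬ B j
        · rw [if_pos hm, decide_eq_true hm, if_pos rfl,
            subst_eq_update _ x y (hκ j) (qx j) (hqx j hm.1.1)]
        · rw [if_neg hm, decide_eq_false hm]
          exact if_neg Bool.false_ne_true
      have hM : (Matrix.of fun i j : Fin r => (G.submatrix (R i)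
          (if decide (E j ∧ ¬ B j) then Function.update (κ j) (qx j) y else κ j)).det) =
          Matrix.of fun i j : Fin r => (G.submatrix (R i) (compress κ x y j)).det := by
        ext i j
        rw [Matrix.of_apply, Matrix.of_apply, hcol j]
      rw [hM]
      exact hG

/-! ## 4. Soundness of word certificates -/

/-- The end configuration of a checked word has injective columns if the start has. -/
theorem lastCfg_injective :
    ∀ (w : List (Fin n × Fin n × (Fin r → Fin d → Fin n))) (κ : Fin r → Fin d → Fin n),
      (∀ j, Function.Injective (κ j)) → stepsOK κ w = true →
      ∀ j, Function.Injective (lastCfg κ w j)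
  | [], κ, hκ, _ => hκ
  | (x, y, κ') :: rest, κ, hκ, hw => by
    simp only [stepsOK, Bool.and_eq_true, decide_eq_true_eq] at hw
    obtain ⟨⟨-, hk'⟩, hrest⟩ := hw
    have hκ' : ∀ j, Function.Injective (κ' j) := by
      rw [hk']
      exact compress_injective κ x y hκ
    exact lastCfg_injective rest κ' hκ' hrest

/-- **Words.** If the word certificate checks and its end configuration is alive against the rows `R`,
then the start configuration is alive against `R` (backwards induction, one `alive_of_compress` per step). -/
theorem alive_of_stepsOK (R : Fin r → Fin d → Fin nr) :
    ∀ (w : List (Fin n × Fin n × (Fin r → Fin d → Fin n))) (κ : Fin r → Fin d → Fin n),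
      (∀ j, Function.Injective (κ j)) → stepsOK κ w = true →
      (∃ G : Matrix (Fin nr) (Fin n) ℂ,
        (Matrix.of fun i j : Fin r => (G.submatrix (R i) (lastCfg κ w j)).det).det ≠ 0) →
      ∃ G : Matrix (Fin nr) (Fin n) ℂ,
        (Matrix.of fun i j : Fin r => (G.submatrix (R i) (κ j)).det).det ≠ 0
  | [], _, _, _, h => h
  | (x, y, κ') :: rest, κ, hκ, hw, h => by
    simp only [stepsOK, Bool.and_eq_true, decide_eq_true_eq] at hw
    obtain ⟨⟨hxy, hk'⟩, hrest⟩ := hw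
    have hκ' : ∀ j, Function.Injective (κ' j) := by
      rw [hk']
      exact compress_injective κ x y hκ
    have h' := alive_of_stepsOK R rest κ' hκ' hrest h
    rw [hk'] at h'
    exact alive_of_compress R κ hκ x y hxy h'

/-- Literal relabelings (independently on rows and columns) preserve aliveness. -/
theorem alive_relabel {nc : ℕ} (ρ : Fin r → Fin d → Fin nr) (κ : Fin r → Fin d → Fin nc)
    (π : Equiv.Perm (Fin nr)) (σ : Equiv.Perm (Fin nc))
    (h : ∃ G : Matrix (Fin nr) (Fin nc) ℂ,
      (Matrix.of fun i j : Fin r => (G.submatrix (ρ i) (κ j)).det).det ≠ 0) :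
    ∃ G : Matrix (Fin nr) (Fin nc) ℂ,
      (Matrix.of fun i j : Fin r => (G.submatrix (fun a => π (ρ i a)) (fun c => σ (κ j c))).det).det
        ≠ 0 := by
  obtain ⟨G, hG⟩ := h
  refine ⟨G.submatrix π.symm σ.symm, ?_⟩
  have hM : (Matrix.of fun i j : Fin r => ((G.submatrix π.symm σ.symm).submatrix
      (fun a => π (ρ i a)) (fun c => σ (κ j c))).det) =
      Matrix.of fun i j : Fin r => (G.submatrix (ρ i) (κ j)).det := by
    ext i j
    simp [Matrix.submatrix_submatrix, Function.comp_def]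
  rw [hM]
  exact hG

/-- **The end of a word.** If every member of `σ ∘ H` (hub `H` with strictly increasing rows, injective;
`σ` a literal relabeling) is covered by a column of `K` (injective columns), then `(σ ∘ H, K)` is alive:
`K` is a rearrangement of `σ ∘ H`, and `Hub.alive_of_rearrangement` applies after relabeling by `σ⁻¹`. -/
theorem alive_of_endOK (H K : Fin r → Fin d → Fin n) (σ : Equiv.Perm (Fin n))
    (hm : ∀ j, StrictMono (H j)) (hi : Function.Injective H) (hK : ∀ j, Function.Injective (K j))
    (h : ∀ j', ∃ j, ∀ q, ∃ q', σ (H j' q) = K j q') :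
    ∃ G : Matrix (Fin n) (Fin n) ℂ,
      (Matrix.of fun i j : Fin r => (G.submatrix (fun a => σ (H i a)) (K j)).det).det ≠ 0 := by
  classical
  set K' : Fin r → Fin d → Fin n := fun j c => σ.symm (K j c) with hK'_def
  have hK' : ∀ j, Function.Injective (K' j) := fun j q₁ q₂ hq => hK j (σ.symm.injective hq)
  have h' : ∀ j', ∃ j, ∀ q, ∃ q', H j' q = K' j q' := by
    intro j'
    obtain ⟨j, hj⟩ := h j'
    refine ⟨j, fun q => ?_⟩
    obtain ⟨q', hq'⟩ := hj q
    exact ⟨q', by rw [hK'_def]; dsimp only; rw [← hq', Equiv.symm_apply_apply]⟩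
  choose s hs using h'
  have hrange : ∀ j', Finset.univ.image (H j') = Finset.univ.image (K' (s j')) := by
    intro j'
    apply Finset.eq_of_subset_of_card_le
    · intro a ha
      obtain ⟨q, -, rfl⟩ := Finset.mem_image.mp ha
      obtain ⟨q', hq'⟩ := hs j' q
      exact Finset.mem_image.mpr ⟨q', Finset.mem_univ _, hq'.symm⟩
    · rw [Finset.card_image_of_injective _ (hK' _), Finset.card_image_of_injective _ (hm j').injective]
  have hcard : ∀ j, (Finset.univ.image (K' j)).card = d := fun j => by
    rw [Finset.card_image_of_injective _ (hK' _), Finset.card_univ, Fintype.card_fin]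
  have hsi : Function.Injective s := by
    intro j₁ j₂ hj
    apply hi
    have e1 := Finset.orderEmbOfFin_unique (hcard (s j₁))
      (f := H j₁) (fun q => by rw [← hrange j₁]; exact Finset.mem_image_of_mem _ (Finset.mem_univ q))
      (hm j₁)
    have e2 := Finset.orderEmbOfFin_unique (hcard (s j₁))
      (f := H j₂) (fun q => by rw [hj, ← hrange j₂]; exact Finset.mem_image_of_mem _ (Finset.mem_univ q))
      (hm j₂)
    exact e1.trans e2.symm
  set π : Equiv.Perm (Fin r) := (Equiv.ofBijective s (Finite.injective_iff_bijective.mp hsi)).symm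
    with hπ_def
  have hsπ : ∀ j, s (π j) = j := fun j =>
    Equiv.ofBijective_apply_symm_apply s (Finite.injective_iff_bijective.mp hsi) j
  have hcov : ∀ j q, ∃ q', K' j q = H (π j) q' := by
    intro j q
    have hmem : K' j q ∈ Finset.univ.image (H (π j)) := by
      rw [hrange (π j), hsπ]
      exact Finset.mem_image_of_mem _ (Finset.mem_univ q)
    obtain ⟨q', -, hq'⟩ := Finset.mem_image.mp hmem
    exact ⟨q', hq'.symm⟩
  have hτ0 : ∀ j, ∃ τ : Equiv.Perm (Fin d), K' j = H (π j) ∘ τ :=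
    fun j => exists_perm_of_covers _ _ (hK' j) (hcov j)
  choose τ hτ using hτ0
  have hHK' := alive_of_rearrangement H K' hm hi π τ hτ
  have hfin := alive_relabel H K' σ σ hHK'
  have hcols : (fun j => fun c => σ (K' j c)) = K := by
    funext j c
    rw [hK'_def]
    exact Equiv.apply_symm_apply σ (K j c)
  have hM : (Matrix.of fun i j : Fin r => ((Classical.choose hfin).submatrix (fun a => σ (H i a))
      (fun c => σ (K' j c))).det) =
      Matrix.of fun i j : Fin r => ((Classical.choose hfin).submatrix (fun a => σ (H i a)) (K j)).det := by
    ext i j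
    rw [Matrix.of_apply, Matrix.of_apply, ← congrFun hcols j]
  exact ⟨Classical.choose hfin, by rw [← hM]; exact Classical.choose_spec hfin⟩

/-- **Word certificate ⟹ alive against the hub.** Hub `H` (strictly increasing rows, injective), literal
relabeling `σ`, start configuration `S` with injective columns, a checked word from `S` whose end covers
`σ ∘ H`: then `(σ⁻¹ ∘ S, H)` is alive (rows the pulled-back layout, columns the hub) — the shape consumed
by the hub lemma. -/
theorem alive_of_wordCert (H : Fin r → Fin d → Fin n) (hm : ∀ j, StrictMono (H j))
    (hi : Function.Injective H) (σ : Equiv.Perm (Fin n)) (S : Fin r → Fin d → Fin n)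
    (hS : ∀ j, Function.Injective (S j)) (w : List (Fin n × Fin n × (Fin r → Fin d → Fin n)))
    (hw : stepsOK S w = true) (he : ∀ j', ∃ j, ∀ q, ∃ q', σ (H j' q) = lastCfg S w j q') :
    ∃ G : Matrix (Fin n) (Fin n) ℂ,
      (Matrix.of fun i j : Fin r => (G.submatrix (fun a => σ.symm (S i a)) (H j)).det).det ≠ 0 := by
  -- (σH, end) alive ⟹ (σH, S) alive ⟹ (S, σH) alive ⟹ relabel by σ⁻¹
  have h1 := alive_of_endOK H (lastCfg S w) σ hm hi (lastCfg_injective w S hS hw) he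
  have h2 := alive_of_stepsOK (fun i a => σ (H i a)) w S hS hw h1
  have h3 := alive_symm (ι := Fin r) _ _ h2
  have h4 := alive_relabel S (fun j c => σ (H j c)) σ.symm σ.symm h3
  have hH : (fun j => fun c => σ.symm (σ (H j c))) = H := by
    funext j c
    exact Equiv.symm_apply_apply σ (H j c)
  obtain ⟨G, hG⟩ := h4
  refine ⟨G, ?_⟩
  have hM : (Matrix.of fun i j : Fin r => (G.submatrix (fun a => σ.symm (S i a))
      (fun c => σ.symm (σ (H j c)))).det) =
      Matrix.of fun i j : Fin r => (G.submatrix (fun a => σ.symm (S i a)) (H j)).det := by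
    ext i j
    simp only [Matrix.of_apply, Equiv.symm_apply_apply]
  rw [← hM]
  exact hG

/-- **Complete certificate.** A threshold hub `H` for the weight `ψ` (strictly increasing rows, injective,
and every strictly increasing `d`-tuple is a member or `ψ`-lighter than every member), two layout sides
`S, T` with injective columns, and two checked words ending at the relabelings `σ₁ ∘ H`, `σ₂ ∘ H`:
then the layout `(S, T)` is alive. Every hypothesis except the words themselves is a `decide`. -/
theorem tt_of_hubCert (H : Fin r → Fin d → Fin n) (ψ : Fin n → ℕ)
    (hm : ∀ j, StrictMono (H j)) (hi : Function.Injective H)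
    (hthr : ∀ a : Fin d → Fin n, StrictMono a →
      (∃ j, a = H j) ∨ ∀ j, (∑ c, ψ (a c)) < ∑ c, ψ (H j c))
    (S T : Fin r → Fin d → Fin n) (hS : ∀ j, Function.Injective (S j))
    (hT : ∀ j, Function.Injective (T j)) (σ₁ σ₂ : Equiv.Perm (Fin n))
    (wS wT : List (Fin n × Fin n × (Fin r → Fin d → Fin n)))
    (hwS : stepsOK S wS = true) (heS : ∀ j', ∃ j, ∀ q, ∃ q', σ₁ (H j' q) = lastCfg S wS j q')
    (hwT : stepsOK T wT = true) (heT : ∀ j', ∃ j, ∀ q, ∃ q', σ₂ (H j' q) = lastCfg T wT j q') :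
    ∃ G : Matrix (Fin n) (Fin n) ℂ,
      (Matrix.of fun i j : Fin r => (G.submatrix (S i) (T j)).det).det ≠ 0 := by
  have hS' := alive_of_wordCert H hm hi σ₁ S hS wS hwS heS
  have hT' := alive_of_wordCert H hm hi σ₂ T hT wT hwT heT
  have hST := alive_trans_of_hub _ _ H ψ hm hi (hub_unique_of_threshold H ψ hi hthr) hS' hT'
  have hfin := alive_relabel _ _ σ₁ σ₂ hST
  obtain ⟨G, hG⟩ := hfin
  refine ⟨G, ?_⟩
  have hM : (Matrix.of fun i j : Fin r => (G.submatrix (fun a => σ₁ (σ₁.symm (S i a)))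
      (fun c => σ₂ (σ₂.symm (T j c)))).det) =
      Matrix.of fun i j : Fin r => (G.submatrix (S i) (T j)).det := by
    ext i j
    have h1 : (fun a => σ₁ (σ₁.symm (S i a))) = S i := funext fun a => Equiv.apply_symm_apply σ₁ _
    have h2 : (fun c => σ₂ (σ₂.symm (T j c))) = T j := funext fun c => Equiv.apply_symm_apply σ₂ _
    rw [Matrix.of_apply, Matrix.of_apply, h1, h2]
  rw [← hM]
  exact hG

/-- Conversion to the item's indexing (`u w : Fin r → Finset (Fin h)`, rows `castAdd`/`natAdd` by
membership): if the literal maps of `(u, w)` ARE `(S, T)` (two `decide`s) and `(S, T)` is alive, the TT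
instance for `(u, w)` holds verbatim. -/
theorem layout_alive_of_eq {h : ℕ} (u w : Fin r → Finset (Fin h)) (S T : Fin r → Fin h → Fin (h + h))
    (hS : (fun (i : Fin r) (a : Fin h) => if a ∈ u i then Fin.castAdd h a else Fin.natAdd h a) = S)
    (hT : (fun (j : Fin r) (c : Fin h) => if c ∈ w j then Fin.natAdd h c else Fin.castAdd h c) = T)
    (hST : ∃ G : Matrix (Fin (h + h)) (Fin (h + h)) ℂ,
      (Matrix.of fun i j : Fin r => (G.submatrix (S i) (T j)).det).det ≠ 0) :
    ∃ G : Matrix (Fin (h + h)) (Fin (h + h)) ℂ, (Matrix.of fun i j : Fin r =>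
      (G.submatrix (fun a : Fin h => if a ∈ u i then Fin.castAdd h a else Fin.natAdd h a)
        (fun c : Fin h => if c ∈ w j then Fin.natAdd h c else Fin.castAdd h c)).det).det ≠ 0 := by
  subst hS hT
  exact hST

end Summit.ValiantsHypothesis.ValiantsHypothesis.Theorems.BarrierLever.HubCert
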